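import Literature.NumberTheory.Automorphic.UpqGKModulePFiltration      -- ★ p831041 (A-p14 (g23)): `upqPFiltration`, `upqPStep`, `upqPStep_le_comap`
import Literature.NumberTheory.Automorphic.UpqComplexifiedAction       -- ★ p831261 (A-p14 (g23)): `upqLieC`, `upqEOp`, `upqFOp`, `ρ𝔤_upqUnit_eq`, `upqLieC_diag_mul_upqEOp_sub`
import Mathlib.LinearAlgebra.Lagrange
import HarnessLib

/-!
# Propagation of torus annihilating polynomials along the `𝔭`-filtration of a `(𝔤, K)`-module of `U(α, β)`

Topic `NumberTheory/Automorphic`; namespace `Literature.NumberTheory.Automorphic`; THEOREMS ONLY (no `def`, no named fact, no instance, no notation, no `sorry`).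
Cell `hodgecm-mathlib`, F0∕P3, T1a arch line, ROAD-GLOB (A6 #92 at `U(2,1)`), brick «FB», piece **T2** of the torus bound (A-p06 (g24) plan 2026-08-31):
if the torus generator `D = ρ𝔤(torusGen a b)` (`a, b` real, all root shifts `b_q − a_p ∈ {−1, 0, 1}`) is killed on `W₀` by `∏_{x ∈ S₀} (D − i x)` for a finite
set of REAL nodes `S₀ ⊂ [−r₀, r₀]` (e.g. the spectrum of the skew operator `D|_{W₀}`, T3), then on the `n`-th level `F n = Σ_{j ≤ n} 𝔭^j · W₀` of ★
`upqPFiltration` it is killed by `∏_{y ∈ S₀ + {|j| ≤ n}} (D − i y)`, all of whose nodes lie in `[−(r₀+n), r₀+n]` — the input of the T1-type bound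
`Re B (D u) (D u) ≤ (r₀+n)² Re B u u` on `F n` (★ `SkewIntegerSpectrumBound` for integer nodes; the real-node twin rides with T3).

THE MECHANISM ([BorelWallach2000, II §1.1, §4.1]; [KnappVogan1995, §IV.1 (root space decomposition)]).  Generic: if `D E = E D + c E` then `P(D − c) E = E P(D)`,
so `P(D) u = 0 ⇒ P(X − c)(D) (E u) = 0` (`apply_aeval_comp_eq_zero`), and `(∏_{k∈S}(X − v_k)).comp (X − C c) = ∏_{k∈S} (X − (v_k + c))` (`nodal_comp_X_sub_C`);
divisibility `S ⊆ T ⇒ nodal S ∣ nodal T` transports kernels (`aeval_nodal_eq_zero_of_subset`); the node sets `S₀ + {|j| ≤ n}` are written as `Finset.image`s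
(no definition).  For `U(α, β)`: `ρ𝔤(x_s) = c E_p + c̄ F_p` (★ `ρ𝔤_upqUnit_eq`) and `[D, E_p] = i (b_{p₂} − a_{p₁}) E_p`, `[D, F_p] = −i (b_{p₂} − a_{p₁}) F_p`
(★ `upqLieC_diag_mul_upqEOp_sub`), so each `𝔭`-step shifts the nodes by an integer of absolute value at most one:
**`upqPFiltration_le_ker_aeval_nodal_torusGen`**.
HONEST LABEL: closes no registered stub by itself.  HC_CM is proved only modulo the 2 remaining named inputs (hLiu418, h413) until rung 0 closes.

## References
* A. Borel, N. Wallach, *Continuous cohomology, discrete subgroups, and representations of reductive groups*, 2nd ed. (2000), II §1.1, §4.1 [BorelWallach2000].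
* A. W. Knapp, D. A. Vogan, *Cohomological Induction and Unitary Representations* (1995), §IV.1 [KnappVogan1995].
-/

-- Mathlib idiom (as in ★ `GKModules`, ★ `UpqComplexifiedAction`): the commutator bracket on `Module.End ℂ V`, to MENTION `ρ𝔤 : 𝔤 →ₗ⁅ℝ⁆ End V`.
attribute [local instance 100] LieRing.ofAssociativeRing

set_option autoImplicit false

noncomputable section

namespace Literature.NumberTheory.Automorphic

open Polynomial Finset
open Literature.RepresentationTheory.KonnoKonno2007 Literature.RepresentationTheory.KonnoKonno2007.RealDualPair
open Literature.RepresentationTheory.BorelWallach2000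

/-! ## §1 Generic: shifting an annihilating polynomial through `[D, E] = c E` -/

section Generic

universe v

variable {V : Type v} [AddCommGroup V] [Module ℂ V]

/-- If `D E = E D + c E` then `P(D − c) ∘ E = E ∘ P(D)` for every polynomial `P`. [cite: KnappVogan1995, §IV.1] -/
theorem aeval_sub_smul_mul_eq (D E : Module.End ℂ V) (c : ℂ) (h : D * E = E * D + c • E) (P : ℂ[X]) :
    aeval (D - c • (1 : Module.End ℂ V)) P * E = E * aeval D P := by
  have hX : (D - c • (1 : Module.End ℂ V)) * E = E * D := by
    rw [sub_mul, h, smul_mul_assoc, one_mul]; abel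
  induction P using Polynomial.induction_on' with
  | add p q hp hq => rw [map_add, map_add, add_mul, mul_add, hp, hq]
  | monomial n a =>
    induction n with
    | zero =>
      rw [Polynomial.monomial_zero_left, aeval_C, aeval_C]
      simp only [Algebra.algebraMap_eq_smul_one, smul_mul_assoc, one_mul, Algebra.mul_smul_comm, mul_one]
    | succ n ih =>
      calc aeval (D - c • (1 : Module.End ℂ V)) (monomial (n + 1) a) * E
          = aeval (D - c • (1 : Module.End ℂ V)) (monomial n a) * ((D - c • (1 : Module.End ℂ V)) * E) := by
            rw [← Polynomial.monomial_mul_X, map_mul, aeval_X, mul_assoc]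
        _ = aeval (D - c • (1 : Module.End ℂ V)) (monomial n a) * E * D := by rw [hX, mul_assoc]
        _ = E * aeval D (monomial n a) * D := by rw [ih]
        _ = E * aeval D (monomial (n + 1) a) := by rw [← Polynomial.monomial_mul_X, map_mul, aeval_X, mul_assoc]

/-- `P(D − c•1) = P(X − C c)(D)`. [cite: KnappVogan1995, §IV.1] -/
theorem aeval_comp_X_sub_C_eq (D : Module.End ℂ V) (c : ℂ) (P : ℂ[X]) :
    aeval D (P.comp (X - Polynomial.C c)) = aeval (D - c • (1 : Module.End ℂ V)) P := by
  rw [aeval_comp, map_sub, aeval_X, aeval_C, Module.algebraMap_end_eq_smul_id]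
  rfl

/-- **Transport of annihilation**: `D E = E D + c E` and `P(D) u = 0` imply `P(X − c)(D) (E u) = 0`. [cite: KnappVogan1995, §IV.1] -/
theorem apply_aeval_comp_eq_zero (D E : Module.End ℂ V) (c : ℂ) (h : D * E = E * D + c • E) (P : ℂ[X]) {u : V}
    (hu : aeval D P u = 0) : aeval D (P.comp (X - Polynomial.C c)) (E u) = 0 := by
  rw [aeval_comp_X_sub_C_eq, ← Module.End.mul_apply, aeval_sub_smul_mul_eq D E c h P, Module.End.mul_apply, hu, map_zero]

/-- `(∏_{k∈S} (X − v k)).comp (X − C c) = ∏_{k∈S} (X − (v k + c))`. [cite: KnappVogan1995, §IV.1] -/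
theorem nodal_comp_X_sub_C {ι : Type*} (S : Finset ι) (v : ι → ℂ) (c : ℂ) :
    (Lagrange.nodal S v).comp (X - Polynomial.C c) = Lagrange.nodal S (fun k => v k + c) := by
  rw [Lagrange.nodal_eq, Lagrange.nodal_eq, Polynomial.prod_comp]
  refine Finset.prod_congr rfl fun k _ => ?_
  rw [sub_comp, X_comp, C_comp, map_add]
  ring

/-- Kernels grow with the node set: `S ⊆ T` and `nodal S (D) u = 0` imply `nodal T (D) u = 0`. [cite: KnappVogan1995, §IV.1] -/
theorem aeval_nodal_eq_zero_of_subset {ι : Type*} [DecidableEq ι] (D : Module.End ℂ V) (v : ι → ℂ) {S T : Finset ι} (hST : S ⊆ T) {u : V}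
    (hu : aeval D (Lagrange.nodal S v) u = 0) : aeval D (Lagrange.nodal T v) u = 0 := by
  have hT : Lagrange.nodal T v = Lagrange.nodal (T \ S) v * Lagrange.nodal S v := by
    rw [Lagrange.nodal_eq, Lagrange.nodal_eq, Lagrange.nodal_eq, Finset.prod_sdiff hST]
  rw [hT, map_mul, Module.End.mul_apply, hu, map_zero]

/-- Re-indexing real nodes under an integer shift: `∏_{x∈S} (X − (i x + i ε)) = ∏_{y ∈ S+ε} (X − i y)`. [cite: KnappVogan1995, §IV.1] -/
theorem nodal_ofReal_add_eq_image (S : Finset ℝ) (ε : ℤ) :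
    Lagrange.nodal S (fun x : ℝ => (x : ℂ) * Complex.I + (ε : ℂ) * Complex.I) =
      Lagrange.nodal (S.image fun x : ℝ => x + ε) (fun x : ℝ => (x : ℂ) * Complex.I) := by
  rw [Lagrange.nodal_eq, Lagrange.nodal_eq, Finset.prod_image fun x _ y _ h => by simpa using h]
  refine Finset.prod_congr rfl fun x _ => ?_
  push_cast
  ring_nf

/-- The node set after `n` steps: `S₀ + {j : |j| ≤ n}` (real base nodes, integer shifts), written WITHOUT a definition as an `image`. Membership bound:
every node has absolute value `≤ r₀ + n` if `|x| ≤ r₀` on `S₀`. [cite: KnappVogan1995, §IV.1] -/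
theorem abs_le_of_mem_image_add (S₀ : Finset ℝ) (r₀ : ℝ) (hS₀ : ∀ x ∈ S₀, |x| ≤ r₀) (n : ℕ) {y : ℝ}
    (hy : y ∈ (S₀ ×ˢ Finset.Icc (-(n : ℤ)) n).image fun p : ℝ × ℤ => p.1 + (p.2 : ℝ)) : |y| ≤ r₀ + n := by
  rw [Finset.mem_image] at hy
  obtain ⟨⟨x, j⟩, hxj, rfl⟩ := hy
  rw [Finset.mem_product, Finset.mem_Icc] at hxj
  have hj : |(j : ℝ)| ≤ n := by
    rw [← Int.cast_abs]; exact_mod_cast abs_le.mpr hxj.2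
  calc |x + (j : ℝ)| ≤ |x| + |(j : ℝ)| := abs_add_le _ _
    _ ≤ r₀ + n := add_le_add (hS₀ x hxj.1) hj

/-- The node set grows by one step under a shift `|ε| ≤ 1`: `(S₀ + {|j| ≤ n}) + ε ⊆ S₀ + {|j| ≤ n+1}`. [cite: KnappVogan1995, §IV.1] -/
theorem image_add_subset_succ (S₀ : Finset ℝ) (n : ℕ) {ε : ℤ} (hε : |ε| ≤ 1) :
    ((S₀ ×ˢ Finset.Icc (-(n : ℤ)) n).image fun p : ℝ × ℤ => p.1 + (p.2 : ℝ)).image (fun x : ℝ => x + ε) ⊆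
      (S₀ ×ˢ Finset.Icc (-((n + 1 : ℕ) : ℤ)) ((n + 1 : ℕ) : ℤ)).image fun p : ℝ × ℤ => p.1 + (p.2 : ℝ) := by
  intro y hy
  simp only [Finset.mem_image, Finset.mem_product, Finset.mem_Icc] at hy ⊢
  obtain ⟨x, ⟨⟨x₀, j⟩, ⟨hx₀, hj1, hj2⟩, rfl⟩, rfl⟩ := hy
  rw [abs_le] at hε
  refine ⟨⟨x₀, j + ε⟩, ⟨hx₀, by push_cast; omega, by push_cast; omega⟩, ?_⟩
  push_cast
  ring

/-- The node set only grows with `n`: `S₀ + {|j| ≤ n} ⊆ S₀ + {|j| ≤ n+1}`. [cite: KnappVogan1995, §IV.1] -/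
theorem image_subset_succ (S₀ : Finset ℝ) (n : ℕ) :
    ((S₀ ×ˢ Finset.Icc (-(n : ℤ)) n).image fun p : ℝ × ℤ => p.1 + (p.2 : ℝ)) ⊆
      (S₀ ×ˢ Finset.Icc (-((n + 1 : ℕ) : ℤ)) ((n + 1 : ℕ) : ℤ)).image fun p : ℝ × ℤ => p.1 + (p.2 : ℝ) := by
  intro y hy
  simp only [Finset.mem_image, Finset.mem_product, Finset.mem_Icc] at hy ⊢
  obtain ⟨⟨x₀, j⟩, ⟨hx₀, hj1, hj2⟩, rfl⟩ := hy
  exact ⟨⟨x₀, j⟩, ⟨hx₀, by push_cast; omega, by push_cast; omega⟩, rfl⟩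

/-- At `n = 0` the node set is `S₀`. [cite: KnappVogan1995, §IV.1] -/
theorem image_zero_eq (S₀ : Finset ℝ) :
    ((S₀ ×ˢ Finset.Icc (-((0 : ℕ) : ℤ)) ((0 : ℕ) : ℤ)).image fun p : ℝ × ℤ => p.1 + (p.2 : ℝ)) = S₀ := by
  ext y
  simp only [Finset.mem_image, Finset.mem_product, Finset.mem_Icc, Nat.cast_zero, neg_zero]
  constructor
  · rintro ⟨⟨x, j⟩, ⟨hx, hj1, hj2⟩, rfl⟩
    have : j = 0 := le_antisymm hj2 hj1
    subst this
    simpa using hx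
  · intro hy
    exact ⟨⟨y, 0⟩, ⟨hy, le_rfl, le_rfl⟩, by simp⟩

end Generic

/-! ## §2 `U(α, β)`: the torus generator against the `𝔭`-steps -/

section Upq

variable {α β : Type} [Fintype α] [DecidableEq α] [Fintype β] [DecidableEq β]
variable {V : Type*} [AddCommGroup V] [Module ℂ V] (ρ𝔤 : (uFormGroup α β).lie →ₗ⁅ℝ⁆ Module.End ℂ V)

/-- `ρ𝔤(torusGen a b)` is the complexified action of the block-diagonal matrix `[[diag(−i a), 0], [0, diag(−i b)]]`. [cite: BorelWallach2000, II §1.1 (5)] -/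
theorem ρ𝔤_torusGen_eq_upqLieC (a : α → ℝ) (b : β → ℝ) :
    ρ𝔤 ⟨torusGen a b, torusGen_mem_lie a b⟩ =
      upqLieC ρ𝔤 (Matrix.fromBlocks (Matrix.diagonal fun l => -((a l : ℂ) * Complex.I)) 0 0 (Matrix.diagonal fun l => -((b l : ℂ) * Complex.I))) := by
  rw [← upqLieC_coe ρ𝔤, Matrix.fromBlocks_diagonal]
  rfl

/-- **`[D, E_p] = i (b_{p₂} − a_{p₁}) E_p`** for `D = ρ𝔤(torusGen a b)` and the `𝔭⁺` matrix unit `E_p`, `p = (p₁, p₂)`. [cite: BorelWallach2000, II §4.1] -/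
theorem torusGen_mul_upqEOp (a : α → ℝ) (b : β → ℝ) (p : α × β) :
    ρ𝔤 ⟨torusGen a b, torusGen_mem_lie a b⟩ * upqEOp ρ𝔤 (Matrix.single p.1 p.2 1) =
      upqEOp ρ𝔤 (Matrix.single p.1 p.2 1) * ρ𝔤 ⟨torusGen a b, torusGen_mem_lie a b⟩ +
        (((b p.2 : ℂ) - a p.1) * Complex.I) • upqEOp ρ𝔤 (Matrix.single p.1 p.2 1) := by
  rw [ρ𝔤_torusGen_eq_upqLieC, ← sub_eq_iff_eq_add', upqLieC_diag_mul_upqEOp_sub, ← map_smul]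
  congr 1
  ext i j
  simp only [Matrix.sub_apply, Matrix.diagonal_mul, Matrix.mul_diagonal, Matrix.smul_apply, Matrix.single_apply, smul_eq_mul]
  by_cases h : p.1 = i ∧ p.2 = j
  · obtain ⟨rfl, rfl⟩ := h
    simp; ring
  · simp [h]

/-- **`[D, F_p] = −i (b_{p₂} − a_{p₁}) F_p`** for the `𝔭⁻` matrix unit `F_p = F_{E_{p₂ p₁}}`. [cite: BorelWallach2000, II §4.1] -/
theorem torusGen_mul_upqFOp (a : α → ℝ) (b : β → ℝ) (p : α × β) :
    ρ𝔤 ⟨torusGen a b, torusGen_mem_lie a b⟩ * upqFOp ρ𝔤 (Matrix.single p.2 p.1 1) =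
      upqFOp ρ𝔤 (Matrix.single p.2 p.1 1) * ρ𝔤 ⟨torusGen a b, torusGen_mem_lie a b⟩ +
        (-(((b p.2 : ℂ) - a p.1) * Complex.I)) • upqFOp ρ𝔤 (Matrix.single p.2 p.1 1) := by
  rw [ρ𝔤_torusGen_eq_upqLieC, ← sub_eq_iff_eq_add', upqLieC_diag_mul_upqFOp_sub, ← map_smul]
  congr 1
  ext i j
  simp only [Matrix.sub_apply, Matrix.diagonal_mul, Matrix.mul_diagonal, Matrix.smul_apply, Matrix.single_apply, smul_eq_mul]
  by_cases h : p.2 = i ∧ p.1 = j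
  · obtain ⟨rfl, rfl⟩ := h
    simp; ring
  · simp [h]

/-- **T2 — PROPAGATION ALONG THE `𝔭`-FILTRATION.**  Let `D = ρ𝔤(torusGen a b)` with every root shift `b_q − a_p` an integer of absolute value `≤ 1`
(e.g. the basis torus generators `−i E_jj`).  If `∏_{x∈S₀} (D − i x)` kills `W₀` (`S₀ ⊂ ℝ` finite — e.g. the spectrum of `D|_{W₀}`), then
`∏_{y ∈ S₀ + {|j| ≤ n}} (D − i y)` kills the level `F n` of ★ `upqPFiltration`; with `|x| ≤ r₀` on `S₀` all these nodes have `|y| ≤ r₀ + n`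
(`abs_le_of_mem_image_add`). [cite: BorelWallach2000, II §4.1] [cite: KnappVogan1995, §IV.1] -/
theorem upqPFiltration_le_ker_aeval_nodal_torusGen (a : α → ℝ) (b : β → ℝ)
    (hab : ∀ p : α × β, ∃ ε : ℤ, |ε| ≤ 1 ∧ (b p.2 : ℝ) - a p.1 = ε) (W₀ : Submodule ℂ V) (S₀ : Finset ℝ)
    (hW₀ : ∀ w ∈ W₀, aeval (ρ𝔤 ⟨torusGen a b, torusGen_mem_lie a b⟩)
      (Lagrange.nodal S₀ fun x : ℝ => (x : ℂ) * Complex.I) w = 0) (n : ℕ) :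
    ∀ u ∈ upqPFiltration ρ𝔤 W₀ n, aeval (ρ𝔤 ⟨torusGen a b, torusGen_mem_lie a b⟩)
      (Lagrange.nodal ((S₀ ×ˢ Finset.Icc (-(n : ℤ)) n).image fun p : ℝ × ℤ => p.1 + (p.2 : ℝ))
        fun x : ℝ => (x : ℂ) * Complex.I) u = 0 := by
  classical
  set D := ρ𝔤 ⟨torusGen a b, torusGen_mem_lie a b⟩ with hD
  set v : ℝ → ℂ := fun x => (x : ℂ) * Complex.I with hv
  induction n with
  | zero => rw [image_zero_eq]; exact hW₀
  | succ n ih =>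
    intro u hu
    rw [upqPFiltration_succ] at hu
    have hker : ∀ u, u ∈ upqPFiltration ρ𝔤 W₀ n ⊔ upqPStep ρ𝔤 (upqPFiltration ρ𝔤 W₀ n) →
        u ∈ LinearMap.ker (aeval D (Lagrange.nodal
          ((S₀ ×ˢ Finset.Icc (-((n + 1 : ℕ) : ℤ)) ((n + 1 : ℕ) : ℤ)).image fun p : ℝ × ℤ => p.1 + (p.2 : ℝ)) v)) := by
      intro u hu
      refine (sup_le ?_ ?_ : upqPFiltration ρ𝔤 W₀ n ⊔ upqPStep ρ𝔤 (upqPFiltration ρ𝔤 W₀ n) ≤ _) hu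
      · -- `F n`: the node set only grows
        intro w hw
        rw [LinearMap.mem_ker]
        exact aeval_nodal_eq_zero_of_subset D v (image_subset_succ S₀ n) (ih w hw)
      · -- `𝔭 · F n`: each generator `ρ𝔤(x_s) w = c E_p w + c̄ F_p w` shifts the nodes by an integer `ε`, `|ε| ≤ 1`
        rw [← Submodule.comap_id (LinearMap.ker _)]
        refine (upqPStep_le_comap (ρ𝔤 := ρ𝔤) LinearMap.id fun s w hw => ?_)
        rw [LinearMap.id_apply, LinearMap.mem_ker]
        have h0 := ih w hw
        obtain ⟨ε, hε, hεeq⟩ := hab s.1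
        have hcε : ((b s.1.2 : ℂ) - a s.1.1) * Complex.I = (ε : ℂ) * Complex.I := by
          have : ((b s.1.2 : ℂ) - a s.1.1) = ((ε : ℤ) : ℝ) := by exact_mod_cast hεeq
          rw [this]; norm_cast
        -- the two pieces
        have hE : aeval D (Lagrange.nodal ((S₀ ×ˢ Finset.Icc (-((n + 1 : ℕ) : ℤ)) ((n + 1 : ℕ) : ℤ)).image
            fun p : ℝ × ℤ => p.1 + (p.2 : ℝ)) v) (upqEOp ρ𝔤 (Matrix.single s.1.1 s.1.2 1) w) = 0 := by
          have h1 := apply_aeval_comp_eq_zero D (upqEOp ρ𝔤 (Matrix.single s.1.1 s.1.2 1)) _ (torusGen_mul_upqEOp ρ𝔤 a b s.1) _ h0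
          rw [hcε, nodal_comp_X_sub_C, hv, nodal_ofReal_add_eq_image] at h1
          exact aeval_nodal_eq_zero_of_subset D v (image_add_subset_succ S₀ n hε) h1
        have hF : aeval D (Lagrange.nodal ((S₀ ×ˢ Finset.Icc (-((n + 1 : ℕ) : ℤ)) ((n + 1 : ℕ) : ℤ)).image
            fun p : ℝ × ℤ => p.1 + (p.2 : ℝ)) v) (upqFOp ρ𝔤 (Matrix.single s.1.2 s.1.1 1) w) = 0 := by
          have h1 := apply_aeval_comp_eq_zero D (upqFOp ρ𝔤 (Matrix.single s.1.2 s.1.1 1)) _ (torusGen_mul_upqFOp ρ𝔤 a b s.1) _ h0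
          have hcε' : -(((b s.1.2 : ℂ) - a s.1.1) * Complex.I) = ((-ε : ℤ) : ℂ) * Complex.I := by rw [hcε]; push_cast; ring
          rw [hcε', nodal_comp_X_sub_C, hv, nodal_ofReal_add_eq_image] at h1
          have hε' : |(-ε)| ≤ 1 := by rwa [abs_neg]
          exact aeval_nodal_eq_zero_of_subset D v (image_add_subset_succ S₀ n hε') h1
        -- `ρ𝔤(x_s) w = c • E_p w + c̄ • F_p w`
        have hxs : ρ𝔤 (upqPBasis s) w = upqPCoeff s.2 • upqEOp ρ𝔤 (Matrix.single s.1.1 s.1.2 1) w +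
            (starRingEnd ℂ) (upqPCoeff s.2) • upqFOp ρ𝔤 (Matrix.single s.1.2 s.1.1 1) w := by
          change ρ𝔤 (upqUnit s.1 (upqPCoeff s.2)) w = _
          rw [ρ𝔤_upqUnit_eq]
          rfl
        rw [hxs, map_add, map_smul, map_smul, hE, hF, smul_zero, smul_zero, add_zero]
    exact hker u hu

end Upq

end Literature.NumberTheory.Automorphic

end
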